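import Summits.BirchSwinnertonDyer.BirchSwinnertonDyer.Theorems.EisensteinPrimesGoodLatticeHeckeCharOfTeichmuller
import Literature.NumberTheory.GaloisRepresentations.ArtinRestriction
import Literature.NumberTheory.GaloisRepresentations.ResidualPairIntegrality
import Literature.NumberTheory.GaloisRepresentations.HeckeCharacterWeakApproximation
import Literature.NumberTheory.EllipticCurves.KellerYin2024.AnomalousLambdaInvariants
import HarnessLib

/-!
# The Hecke character of a Teichmüller character is UNIQUE (`IsHeckeCharOf ι θ θK` determines `θK`)
# — crux 2 `GoodLatticeBDPValue`, θK-axis of the content stub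

Cell `bsd-eis`, width seat `bsd-line-x1-p1-w2` gen 15, crux 2 (stmt-BirchSwinnertonDyer-19032), line
`halves` v33N; helper `--supports`, closes no stub. PROVED, no named fact, no `sorry`. Companion of
(F1a) `EisensteinPrimesMuLambda.exists_heckeCharacter_of_pow_eq_one` (EXISTENCE of `θ_K` by Artin
reciprocity): here UNIQUENESS — if `θ : Γ_K → GL₁(𝓞)` is `(p − 1)`-torsion (a Teichmüller lift, as
in `KellerYin2024.IsResidualPairOver`) and `θK`, `θK'` both satisfy `KellerYin2024.IsHeckeCharOf ι θ ·`
("at every place where `θ` is unramified, `θ_K` is unramified with `θ_K(ϖ_w) = ι(θ(Frob_w))`"), then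
`θK = θK'`: `θ` has open kernel (Teichmüller rigidity: `‖θ(σ) − 1‖ < 1 ⇒ θ(σ) = 1`), hence is
unramified at all but finitely many `w` (`FramedGaloisRep.eventually_isUnramifiedAt_of_isOpen_ker`);
there both characters take the value `ι(θ(Frob_w))` at an arithmetic Frobenius (the Frobenius
polynomial of an unramified rank-one representation IS `X − θ(Frob_w)`,
`IsUnramifiedAt.hasFrobCharpolyAt_charpoly`, `charpoly_eq_of_rank_one`); a Hecke character is
determined by almost all its values at uniformizers (`HeckeCharacter.ext_of_eventually_valueAtUniformizer_eq`,
Cassels–Fröhlich VII Prop. 4.1). So the binder `∀ θK, IsHeckeCharOf ι' θquot θK → …` of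
`KellerYin2024.thm222_anacong_goodLattice_{of_ne_one,of_five_le,of_fullDescentDatum,OPEN}` ranges over
ONE Hecke character (content-stub binder audit, evidence #46 on the item, θK-axis in the kernel).
HONEST FRAMING: 0 stubs / cells / labels / tiers move; by-name surface of crux 2 unchanged (6); no
summit statement, no case of BSD, no crux or stub is proved here.
References: [CasselsFrohlichANT1967] Ch. VII §4 Prop. 4.1, §5.1; [CastellaGrossiLeeSkinner2022] Thm. 2.1.2
(`θ_K`); [SerreAbelianLadic1968] Ch. I §2.1; [KellerYin2024] §1.1 (TeX L441).
-/

noncomputable section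

open scoped Classical

open NumberField IsDedekindDomain Field Polynomial Filter
open Literature.NumberTheory.EllipticCurves Literature.NumberTheory.GaloisRepresentations
open Literature.NumberTheory.EllipticCurves.KellerYin2024

-- `Summit.BirchSwinnertonDyer.BirchSwinnertonDyer.…`: the summit and its single sub-problem share a name (D-0017 layout).
set_option linter.dupNamespace false

namespace Summit.BirchSwinnertonDyer.BirchSwinnertonDyer.Theorems.GoodLatticeHeckeCharUnique

variable {K : Type} [Field K] [NumberField K] {p : ℕ} [hp : Fact p.Prime]
  (S : Set (PadicAlgCl p)) (ι : PadicAlgCl p ≃+* ℂ)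

omit [NumberField K] in
/-- **A Teichmüller character has open kernel**: the subgroup `ker θ` contains the open
neighbourhood `{σ : ‖θ(σ)₀₀ − 1‖ < 1}` of `1` (a `(p−1)`-th root of unity congruent to `1` is `1`,
`eq_one_of_pow_eq_one_of_norm_sub_one_lt_one`). [cite: SerreAbelianLadic1968, Ch. I §2.1]
[cite: LangCyclotomic1990, Ch. 1 §2 (Teichmüller representatives)] -/
theorem isOpen_ker_of_pow_eq_one (θ : FramedGaloisRep K (padicCoeffIntegers S) 1)
    (hθ : ∀ σ : absoluteGaloisGroup K, θ σ ^ (p - 1) = 1) :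
    IsOpen (θ.toMonoidHom.ker : Set (absoluteGaloisGroup K)) := by
  apply Subgroup.isOpen_of_mem_nhds (g := 1)
  have hU : IsOpen {σ : absoluteGaloisGroup K |
      ‖((entry S θ σ : padicCoeffIntegers S) : PadicAlgCl p) - 1‖ < 1} :=
    isOpen_lt ((EisensteinPrimesMuLambda.continuous_coe_entry S θ).sub continuous_const).norm
      continuous_const
  refine mem_of_superset (hU.mem_nhds ?_) fun σ hσ ↦ ?_
  · change ‖((entry S θ 1 : padicCoeffIntegers S) : PadicAlgCl p) - 1‖ < 1
    rw [EisensteinPrimesMuLambda.entry_eq_one_of_apply_eq_one S θ (map_one θ), OneMemClass.coe_one,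
      sub_self, norm_zero]
    exact one_pos
  · -- `θ(σ)₀₀` is a `(p-1)`-th root of unity within `1` of `1`, hence `1`; so `θ σ = 1`
    have hpow : ((entry S θ σ : padicCoeffIntegers S) : PadicAlgCl p) ^ (p - 1) = 1 := by
      have h := congrArg ((↑) : padicCoeffIntegers S → PadicAlgCl p)
        (EisensteinPrimesMuLambda.entry_pow_eq_one_of_pow_eq_one S θ σ (hθ σ))
      push_cast at h
      exact h
    have hone : ((entry S θ σ : padicCoeffIntegers S) : PadicAlgCl p) = 1 :=
      EisensteinPrimesMuLambda.eq_one_of_pow_eq_one_of_norm_sub_one_lt_one hpow hσ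
    change θ σ = 1
    refine Matrix.GeneralLinearGroup.ext fun i j ↦ ?_
    rw [Subsingleton.elim i 0, Subsingleton.elim j 0, Units.val_one, Matrix.one_apply_eq]
    exact Subtype.ext (by rw [OneMemClass.coe_one, ← hone]; rfl)

/-- **A Teichmüller character is unramified at all but finitely many places** (open kernel +
`FramedGaloisRep.eventually_isUnramifiedAt_of_isOpen_ker`). [cite: SerreAbelianLadic1968, Ch. I §2.1] -/
theorem eventually_isUnramifiedAt_of_pow_eq_one (θ : FramedGaloisRep K (padicCoeffIntegers S) 1)
    (hθ : ∀ σ : absoluteGaloisGroup K, θ σ ^ (p - 1) = 1) :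
    ∀ᶠ w : HeightOneSpectrum (𝓞 K) in cofinite, θ.IsUnramifiedAt w :=
  θ.eventually_isUnramifiedAt_of_isOpen_ker (isOpen_ker_of_pow_eq_one S θ hθ)

/-- **The Hecke character of a Teichmüller character is unique**: for `θ : Γ_K → GL₁(𝓞)` with
`θ^{p−1} = 1`, any two `θK`, `θK'` with `IsHeckeCharOf ι θ θK`, `IsHeckeCharOf ι θ θK'` are equal —
at the cofinitely many `w` where `θ` is unramified both equal `ι(θ(Frob_w))` at an arithmetic
Frobenius (`IsUnramifiedAt.hasFrobCharpolyAt_charpoly`, `charpoly_eq_of_rank_one`), and a Hecke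
character is determined by almost all of its values at uniformizers
(`HeckeCharacter.ext_of_eventually_valueAtUniformizer_eq`). Reading lemma for the binder
`∀ θK, IsHeckeCharOf ι' θquot θK → …` of `KellerYin2024.thm222_anacong_goodLattice_{…}`.
[cite: CasselsFrohlichANT1967, Ch. VII §4 Prop. 4.1 (proof)] [cite: CastellaGrossiLeeSkinner2022, Thm. 2.1.2 (θ_K; arXiv:2008.02571v2 TeX L1015–1032)] -/
theorem heckeCharOf_unique {θ : FramedGaloisRep K (padicCoeffIntegers S) 1}
    (hθ : ∀ σ : absoluteGaloisGroup K, θ σ ^ (p - 1) = 1) {θK θK' : HeckeCharacter K}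
    (h : IsHeckeCharOf ι θ θK) (h' : IsHeckeCharOf ι θ θK') : θK = θK' := by
  refine HeckeCharacter.ext_of_eventually_valueAtUniformizer_eq
    ((eventually_isUnramifiedAt_of_pow_eq_one S θ hθ).mono fun w hw ↦ ?_)
  obtain ⟨𝔓, h𝔓⟩ := w.primesAbove_nonempty
  obtain ⟨Φ, hΦ⟩ := HeightOneSpectrum.exists_isArithFrobAt_of_mem_primesAbove_holds h𝔓
  -- the Frobenius polynomial of `θ` at `w` is `X - θ(Φ)₀₀ = X - C (entry θ Φ)`
  have hfrob : θ.HasFrobCharpolyAt w (X - C (entry S θ Φ)) := by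
    have h1 := hw.hasFrobCharpolyAt_charpoly h𝔓 hΦ
    rwa [FramedGaloisRep.charpoly_eq_of_rank_one] at h1
  rw [(h w hw).2 _ hfrob, (h' w hw).2 _ hfrob]

/-- **Corollary for residual pairs**: the Hecke character of the quotient character `θquot` of a
residual pair `IsResidualPairOver WK p θsub θquot` is unique. [cite: KellerYin2024, §1.4 display (char to f) and §2.1.2 Thm. 2.1.3 (arXiv:2402.12781v2)] -/
theorem heckeCharOf_quot_unique {WK : WeierstrassCurve K}
    {θsub θquot : FramedGaloisRep K (padicCoeffIntegers S) 1}
    (hpair : IsResidualPairOver WK p θsub θquot) {θK θK' : HeckeCharacter K}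
    (h : IsHeckeCharOf ι θquot θK) (h' : IsHeckeCharOf ι θquot θK') : θK = θK' :=
  heckeCharOf_unique S ι (fun σ ↦ (hpair.pow_sub_one σ).2) h h'

end Summit.BirchSwinnertonDyer.BirchSwinnertonDyer.Theorems.GoodLatticeHeckeCharUnique

end
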